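import Summits.CriticalPhenomena.PercolationContinuityZ3.Theorems.PercNearOneGluingNoHeavyLowerTailSahiCombTriWDualPair

/-!
# `TRI_W(P;F,G) + TRI_W(P;F†,G) ≥ 0` — the DUAL-FAMILY orbit sum, every index cube

Support file of the one-cut programme (crux `NoHeavyLowerTail`, stmt-CriticalPhenomena-4575; cell `prim-masterthm`, seat P5 gen 21; memo
`FROM-prim-masterthm-p5-g21-SELF-DUAL-AND-FACES.md` §2(b)).  Companion of `…SahiCombTriWDualPair` (`0 ≤ triW P F G + triW P† F G`).

The DUAL of a monotone family of up-sets `F` is `F† x := (refl (F xᶜ))ᶜ` — as an up-set of the product cube, `prodSet F† = (refl (prodSet F))ᶜ`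
(`prodSet_dualFamily`); `F† = F` exactly when `F` is a self-dual family.  In the dipole configuration `(X, Y, h, t) = (𝒫, 𝔾, 𝔽, 1_β)` behind
`triW P F G` the family `F` sits in the TEST slot `h`; exchanging the rôles of `X` and `h` (`t ↦ tᶜ`, a bookkeeping identity) and applying
`dipoleSlack_add_dual_nonneg` to `X' = prodSet F` gives:

* `FiveUpSet.dipoleSlack_add_dual_test_nonneg` — for all up-sets `X, Y, h` and any `t`: slack`(X,Y,h,t)` + slack`(X,Y,h†,t)` `≥ 0`, `h† = (refl h)ᶜ`;
* **`FiveUpSet.triW_add_triW_dualFamily_nonneg`** — `0 ≤ triW P F G + triW P F† G` for every up-set `P`, every index cube, every cube and all monotone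
  families of up-sets `F, G` (and, by `triW_symm`, the same with `G†`).
Together with `triW_add_triW_dual_nonneg` (dual of `P`) and `triW_add_triW_swap_nonneg` (`a = 2`, middle-level swap): every one of these involutions of the
configuration space has non-negative ORBIT SUMS, proved by Kleitman-type counting, while `TriWIneq` asks for non-negativity pointwise on the orbit.
HONEST LABEL: unconditional (std axioms); `TriWIneq` remains OPEN. [this work]
-/

namespace Summit.CriticalPhenomena.PercolationContinuityZ3.Theorems

namespace FiveUpSet

open Finset
open scoped symmDiff

variable {α : Type} [DecidableEq α] [Fintype α]

/-- **Slack of a configuration plus slack with the test set replaced by its dual.**  For up-sets `X, Y, h` and any `t`, with `h† = (refl h)ᶜ`: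
the two dipole slacks of `(X, Y, h, t)` and `(X, Y, h†, t)` add up to a non-negative number.  (Exchange `X ↔ h`, `t ↦ tᶜ`, then
`dipoleSlack_add_dual_nonneg`.) [this work] -/
theorem dipoleSlack_add_dual_test_nonneg (X Y h : Finset (Finset α)) (t : Finset α)
    (hX : IsUpperSet (X : Set (Finset α))) (hY : IsUpperSet (Y : Set (Finset α))) (hh : IsUpperSet (h : Set (Finset α))) :
    ((refl X ∩ Y ∩ h).card + (X ∩ refl Y ∩ h).card + (refl (X ∩ Y) ∩ h).card)
      + ((refl X ∩ Y ∩ (refl h)ᶜ).card + (X ∩ refl Y ∩ (refl h)ᶜ).card + (refl (X ∩ Y) ∩ (refl h)ᶜ).card)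
      ≤ (2 * (X ∩ Y ∩ h).card + (refl X ∩ transl t Y ∩ h).card)
      + (2 * (X ∩ Y ∩ (refl h)ᶜ).card + (refl X ∩ transl t Y ∩ (refl h)ᶜ).card) := by
  have key := dipoleSlack_add_dual_nonneg h Y X tᶜ hh hY hX
  -- rewrite the ten terms of `key` (configurations (h,Y,X,tᶜ) and ((refl h)ᶜ,Y,X,tᶜ)) into the ten terms of the goal
  have cs : ∀ s : Finset α, sᶜ ∆ t = s ∆ tᶜ := by
    intro s; ext j; simp only [mem_symmDiff, mem_compl]; tauto
  have e1 : (refl h ∩ Y ∩ X).card = (refl (X ∩ Y) ∩ h).card := by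
    rw [← card_refl (refl (X ∩ Y) ∩ h)]
    congr 1; ext s; simp only [mem_refl, mem_inter, compl_compl]; tauto
  have e2 : (h ∩ refl Y ∩ X).card = (X ∩ refl Y ∩ h).card := by
    congr 1; ext s; simp only [mem_inter]; tauto
  have e3 : (refl (h ∩ Y) ∩ X).card = (refl X ∩ Y ∩ h).card := by
    rw [← card_refl (refl X ∩ Y ∩ h)]
    congr 1; ext s; simp only [mem_refl, mem_inter, compl_compl]; tauto
  have e4 : (h ∩ Y ∩ X).card = (X ∩ Y ∩ h).card := by
    congr 1; ext s; simp only [mem_inter]; tauto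
  have e5 : (refl h ∩ transl tᶜ Y ∩ X).card = (refl X ∩ transl t Y ∩ h).card := by
    rw [← card_refl (refl X ∩ transl t Y ∩ h)]
    congr 1; ext s; simp only [mem_refl, mem_inter, compl_compl, mem_transl, cs]; tauto
  have f1 : (refl (refl h)ᶜ ∩ Y ∩ X).card = (refl (X ∩ Y) ∩ (refl h)ᶜ).card := by
    rw [← card_refl (refl (X ∩ Y) ∩ (refl h)ᶜ)]
    congr 1; ext s; simp only [mem_refl, mem_inter, mem_compl, compl_compl]; tauto
  have f2 : ((refl h)ᶜ ∩ refl Y ∩ X).card = (X ∩ refl Y ∩ (refl h)ᶜ).card := by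
    congr 1; ext s; simp only [mem_inter]; tauto
  have f3 : (refl ((refl h)ᶜ ∩ Y) ∩ X).card = (refl X ∩ Y ∩ (refl h)ᶜ).card := by
    rw [← card_refl (refl X ∩ Y ∩ (refl h)ᶜ)]
    congr 1; ext s; simp only [mem_refl, mem_inter, mem_compl, compl_compl]; tauto
  have f4 : ((refl h)ᶜ ∩ Y ∩ X).card = (X ∩ Y ∩ (refl h)ᶜ).card := by
    congr 1; ext s; simp only [mem_inter]; tauto
  have f5 : (refl (refl h)ᶜ ∩ transl tᶜ Y ∩ X).card = (refl X ∩ transl t Y ∩ (refl h)ᶜ).card := by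
    rw [← card_refl (refl X ∩ transl t Y ∩ (refl h)ᶜ)]
    congr 1; ext s; simp only [mem_refl, mem_inter, mem_compl, compl_compl, mem_transl, cs]; tauto
  rw [e1, e2, e3, e4, e5, f1, f2, f3, f4, f5] at key
  linarith

/-! ### The `triW` consequence -/

variable {β γ : Type} [DecidableEq β] [Fintype β] [DecidableEq γ] [Fintype γ]

/-- The cylinder of the dual family `x ↦ (refl (F xᶜ))ᶜ` is the dual `(refl ·)ᶜ` of the cylinder of `F`. [this work] -/
theorem prodSet_dualFamily (F : Finset β → Finset (Finset γ)) :
    prodSet (fun x => (refl (F xᶜ))ᶜ) = (refl (prodSet F))ᶜ := by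
  classical
  ext u
  rw [mem_prodSet, mem_compl, mem_refl, mem_compl, mem_refl, mem_prodSet,
    LatticeFiveUpSet.toRight_compl, LatticeFiveUpSet.toLeft_compl]

/-- **`TRI(P;F,G) + TRI(P;F†,G) ≥ 0`.**  For every up-set `P`, all monotone families of up-sets `F, G` (every index cube, every cube) and the dual family
`F† x = (refl (F xᶜ))ᶜ`: `0 ≤ triW P F G + triW P F† G`. [this work] -/
theorem triW_add_triW_dualFamily_nonneg (P : Finset (Finset γ)) (F G : Finset β → Finset (Finset γ))
    (hP : IsUpperSet (P : Set (Finset γ)))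
    (hF : ∀ x, IsUpperSet (F x : Set (Finset γ))) (hG : ∀ x, IsUpperSet (G x : Set (Finset γ)))
    (hFm : Monotone F) (hGm : Monotone G) :
    0 ≤ triW P F G + triW P (fun x => (refl (F xᶜ))ᶜ) G := by
  classical
  rw [← triWGen_const_eq_triW P F G, ← triWGen_const_eq_triW P (fun x => (refl (F xᶜ))ᶜ) G,
    triWGen_eq_dipoleSlack, triWGen_eq_dipoleSlack, prodSet_dualFamily]
  have hX : IsUpperSet ((prodSet (fun _ : Finset β => P) : Finset (Finset (β ⊕ γ))) : Set (Finset (β ⊕ γ))) :=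
    isUpperSet_prodSet (fun _ => hP) (fun _ _ _ => le_rfl)
  have key := dipoleSlack_add_dual_test_nonneg (prodSet (fun _ : Finset β => P)) (prodSet G) (prodSet F) (betaFlip β γ)
    hX (isUpperSet_prodSet hG hGm) (isUpperSet_prodSet hF hFm)
  have keyZ : (((refl (prodSet fun _ : Finset β => P) ∩ prodSet G ∩ prodSet F).card : ℤ)
        + ((prodSet fun _ : Finset β => P) ∩ refl (prodSet G) ∩ prodSet F).card
        + (refl ((prodSet fun _ : Finset β => P) ∩ prodSet G) ∩ prodSet F).card)
      + (((refl (prodSet fun _ : Finset β => P) ∩ prodSet G ∩ (refl (prodSet F))ᶜ).card : ℤ)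
        + ((prodSet fun _ : Finset β => P) ∩ refl (prodSet G) ∩ (refl (prodSet F))ᶜ).card
        + (refl ((prodSet fun _ : Finset β => P) ∩ prodSet G) ∩ (refl (prodSet F))ᶜ).card)
      ≤ (2 * (((prodSet fun _ : Finset β => P) ∩ prodSet G ∩ prodSet F).card : ℤ)
          + (refl (prodSet fun _ : Finset β => P) ∩ transl (betaFlip β γ) (prodSet G) ∩ prodSet F).card)
        + (2 * (((prodSet fun _ : Finset β => P) ∩ prodSet G ∩ (refl (prodSet F))ᶜ).card : ℤ)
          + (refl (prodSet fun _ : Finset β => P) ∩ transl (betaFlip β γ) (prodSet G) ∩ (refl (prodSet F))ᶜ).card) := by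
    exact_mod_cast key
  linarith

end FiveUpSet

end Summit.CriticalPhenomena.PercolationContinuityZ3.Theorems
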